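import Summits.QuantumFields.YangMills.Theorems.BalabanLadderUVSeamRecAveragedPlaquetteRarityZero
import Summits.QuantumFields.YangMills.Theorems.BalabanLadderUVSeamRecBlockAvgSU2PlaquetteBound
import HarnessLib

/-!
# `AveragedPlaquetteRarity` at every FIXED depth (line `rarity_union_bound`, crux `UVSeamRec`, stmt-QuantumFields-20043)

The multiscale mechanism behind the line statement `RarityUnionBound.AveragedPlaquetteRarity` (large-field rarity of ONE Bałaban-averaged
plaquette as a Wilson probability), carried out at every fixed averaging depth `k` by induction on `k`:

* base `k = 0`: the finest-level single-plaquette tail, uniform in the volume (`averagedPlaquetteRarity_depth_zero`, chessboard engine of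
  the Literature);
* step `k → k+1`: a `δ`-rough plaquette of the `(k+1)`-fold average forces an `a`-rough plaquette of the `k`-fold average among the
  `9·L⁴·16` (block, offset, orientation) labels around it, `a = δ/(L² + 2(6L)²) = δ/(73L²)` (contrapositive of the LOCAL one-step propagation
  `dist1_plaqHol_blockAvg_su2Mean_lt_local` for the typed averaging `blockAvg su2Mean`; labels by `Site.blockSite`/`Site.blockEquiv`); the
  induction hypothesis at `(a, ε/(9·L⁴·16))` and a union bound close the step — the COUNT does not grow with `k`, the thresholds do.

Result `averagedPlaquetteRarity_fixedDepth k`: for every `k`, admissible `L`, `δ ∈ (0,1]`, `ε > 0` there is `β₄(k, L, δ, ε)` with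
`(μ_β {V | δ ≤ dist1 (∂(Q_k V))(pl)}).toReal ≤ ε` for all `β ≥ β₄`, all family tori `F.P K` (`F.L = L`, `k + 1 ≤ m + K`) and all level-`k`
plaquettes — i.e. the stub's statement with `β₄` depending on `k` (and no window).  SCOPE (numbers): per level `δ ↦ δ/(73L²)`, so after `k`
levels the finest threshold is `δ/(73L²)^k` and the tail is `exp(−β δ²/(2·(73L²)^{2k}))`; over the stub's window `L^k·uRec β ≤ ℓ₄` the depth
reaches `k ≈ β/(4 b₀ log L)`, where `(73L²)^{−2k} ≈ exp(−β (log 73 + 2 log L)/(2 b₀ log L))` — the bound is vacuous there: uniformity in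
`k` (asymptotic freedom, Bałaban's large-field rarity for averaged fields) is NOT touched.  Nothing of E0′, NT or the gap; YM mass gap NOT proved.
-/

set_option autoImplicit false

noncomputable section

namespace Summit.QuantumFields.YangMills.Cruxes.UVSeamRec.RarityUnionBound

open MeasureTheory Filter Topology
open Literature.MathematicalPhysics.QuantumFieldTheory
open Literature.MathematicalPhysics.QuantumFieldTheory.Balaban1983to89
open Literature.MathematicalPhysics.QuantumFieldTheory.Balaban1983to89.T4Continuum
open Literature.MathematicalPhysics.QuantumFieldTheory.Balaban1983to89.BlockAveraging
open Literature.MathematicalPhysics.QuantumLattice (fundamentalRep fundamentalLatticeRep)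

/-! ## Every FIXED depth `k`: induction on `k` (one deterministic multiscale step + a local union bound per level) -/

/-- **`AveragedPlaquetteRarity` AT EVERY FIXED DEPTH `k`** (the statement of the line's stub `stub_averagedPlaquetteRarity` with the
threshold `β₄` allowed to depend on the depth, and without the window hypothesis): for every `k`, every admissible `L`, every
`δ ∈ (0,1]` and `ε > 0` there is `β₄ = β₄(k, L, δ, ε)` such that for `β ≥ β₄`, on EVERY family torus `F.P K` with `F.L = L`,
`k + 1 ≤ m + K`, and for EVERY level-`k` plaquette `pl`, `(μ_β {V | δ ≤ dist1 (∂(Q_k V))(pl)}).toReal ≤ ε`,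
`Q_k V = Averaging.iter (blockAvg su2Mean) k (ofConfig V)`.  Induction on `k`: `k = 0` is the chessboard tail
(`averagedPlaquetteRarity_depth_zero`); `k → k+1`: if the level-`(k+1)` plaquette is `δ`-rough then (contrapositive of
`dist1_plaqHol_blockAvg_su2Mean_lt_local` at `a = δ/(L² + 2(6L)²) = δ/(73L²)`) one of the level-`k` plaquettes labelled by
(one of nine blocks, an offset in `(Fin 4 → Fin L)`, an orientation) — `9·L⁴·16` labels, `Site.blockSite`/`blockEquiv` — is `a`-rough;
apply the induction hypothesis at `(a, ε/(9·L⁴·16))` and the union bound.  The count does NOT grow with `k`, but the thresholds do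
(`δ ↦ δ/73L²`, `ε ↦ ε/(144·9·L⁴)` per level), so `β₄` depends on `k`: uniformity in `k` over the window `L^k·uRec β ≤ ℓ₄` — the stub —
is NOT obtained (at the top of the window `(73L²)^{−2k} ≈ exp(−β(log 73 + 2 log L)/(2 b₀ log L))` defeats the tail `e^{−β a_k²/2}`). -/
theorem averagedPlaquetteRarity_fixedDepth (k : ℕ) :
    letI : MeasurableSpace (Matrix.specialUnitaryGroup (Fin 2) ℂ) := borel _
    haveI : BorelSpace (Matrix.specialUnitaryGroup (Fin 2) ℂ) := ⟨rfl⟩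
    ∀ L : ℕ, Odd L → 11 < L → ∀ δ : ℝ, 0 < δ → δ ≤ 1 → ∀ ε : ℝ, 0 < ε → ∃ β₄ : ℝ, ∀ β : ℝ, β₄ ≤ β →
      ∀ (F : T4Family) (K : ℕ), F.L = L → k + 1 ≤ F.m + K →
        haveI : NeZero ((F.P K).sitesPerDir 0) := ⟨Params.sitesPerDir_ne_zero _ _⟩
        let Q : GaugeConfig 4 ((F.P K).sitesPerDir 0) (Matrix.specialUnitaryGroup (Fin 2) ℂ) →
            GaugeField (F.P K) k (Matrix.specialUnitaryGroup (Fin 2) ℂ) :=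
          fun V => Averaging.iter (fun j => BlockAveraging.blockAvg (P := F.P K) (j := j) su2Mean) k
            (ofConfig (P := F.P K) (j := 0) V)
        let μ := wilsonMeasure (d := 4) (L := (F.P K).sitesPerDir 0) (fundamentalLatticeRep 2).ρ β
        ∀ pl : Plaq (F.P K) k, (μ {V | δ ≤ dist1 (GaugeField.plaqHol (Q V) pl)}).toReal ≤ ε := by
  classical
  induction k with
  | zero =>
    intro L _ _ δ hδ _ ε hε
    obtain ⟨β₄, hβ₄⟩ := averagedPlaquetteRarity_depth_zero δ hδ ε hε
    exact ⟨β₄, fun β hβ F K _ _ => hβ₄ β hβ F K⟩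
  | succ k ih =>
    intro L hLodd hL11 δ hδ hδ1 ε hε
    have hL0 : (0 : ℝ) < L := by exact_mod_cast (show 0 < L by omega)
    have hL1 : (1 : ℝ) ≤ L := by exact_mod_cast (show 1 ≤ L by omega)
    -- the one-step constant `C = L² + 2(6L)² = 73 L²`, the finer threshold `a = δ/C`, the count `N = 9·L⁴·16`
    set C : ℝ := (L : ℝ) ^ 2 + 2 * (((4 + 2) * L : ℕ) : ℝ) ^ 2 with hC
    have hC73 : C = 73 * (L : ℝ) ^ 2 := by rw [hC]; push_cast; ring
    have hCpos : 0 < C := by positivity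
    have hC1 : 1 ≤ C := by rw [hC73]; nlinarith
    set a : ℝ := δ / C with ha
    have ha0 : 0 < a := div_pos hδ hCpos
    have ha1 : a ≤ 1 := by
      rw [ha, div_le_one hCpos]
      exact hδ1.trans hC1
    set N : ℝ := ((9 * L ^ 4 * 16 : ℕ) : ℝ) with hN
    have hNpos : 0 < N := by rw [hN]; positivity
    -- the induction hypothesis at the finer threshold and the divided probability
    obtain ⟨β₄, hβ₄⟩ := ih L hLodd hL11 a ha0 ha1 (ε / N) (div_pos hε hNpos)
    refine ⟨β₄, fun β hβ F K hFL hK => ?_⟩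
    intro Q μ pl
    haveI : IsProbabilityMeasure μ :=
      isProbabilityMeasure_wilsonMeasure (d := 4) (L := (F.P K).sitesPerDir 0) (fundamentalLatticeRep 2).ρ
        (fundamentalLatticeRep 2).continuous β
    have hj : k + 1 ≤ (F.P K).m + (F.P K).K := by
      show k + 1 ≤ F.m + K
      omega
    have hk' : k + 1 ≤ F.m + K := by omega
    have hPL : (F.P K).L = L := hFL
    have hPd : (F.P K).d = 4 := rfl
    -- the guard and the constant of the one-step propagation at `P = F.P K`
    have hguard : (((((F.P K).d + 2) * (F.P K).L : ℕ) : ℝ) ^ 2 / 4) * a < 1 := by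
      rw [hPd, hPL, ha, hC73]
      rw [show ((((4 + 2) * L : ℕ) : ℝ) ^ 2 / 4) = 9 * (L : ℝ) ^ 2 by push_cast; ring]
      rw [show 9 * (L : ℝ) ^ 2 * (δ / (73 * (L : ℝ) ^ 2)) = 9 * δ / 73 by field_simp]
      rw [div_lt_one (by norm_num)]
      linarith
    have hconst : (((F.P K).L : ℝ) ^ 2 + 2 * ((((F.P K).d + 2) * (F.P K).L : ℕ) : ℝ) ^ 2) * a = δ := by
      rw [hPd, hPL, ← hC, ha]
      field_simp
    -- the level-`k` field and the level-`k` plaquettes based in the nine blocks around `pl`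
    set nineL : List (Site (F.P K) (k + 1)) := [pl.src, pl.src.shift pl.μ, pl.src.unshift pl.μ, pl.src.shift pl.ν,
        pl.src.unshift pl.ν, (pl.src.shift pl.μ).shift pl.ν, (pl.src.shift pl.ν).shift pl.μ, (pl.src.shift pl.μ).unshift pl.ν,
        (pl.src.shift pl.ν).unshift pl.μ] with hnineL
    have hlen : nineL.length = 9 := by rw [hnineL]; rfl
    let s : Fin nineL.length × ((Fin (F.P K).d → Fin (F.P K).L) × (Fin (F.P K).d × Fin (F.P K).d)) →
        Set (GaugeConfig 4 ((F.P K).sitesPerDir 0) (Matrix.specialUnitaryGroup (Fin 2) ℂ)) :=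
      fun x => if h : x.2.2.1 < x.2.2.2 then
        {V | a ≤ dist1 (GaugeField.plaqHol
          (Averaging.iter (fun j => BlockAveraging.blockAvg (P := F.P K) (j := j) su2Mean) k
            (ofConfig (P := F.P K) (j := 0) V))
          ⟨Site.blockSite (nineL.get x.1) x.2.1, x.2.2.1, x.2.2.2, h⟩)} else ∅
    -- (i) a rough level-(k+1) plaquette forces a rough level-k plaquette nearby
    have hsub : {V | δ ≤ dist1 (GaugeField.plaqHol (Q V) pl)} ⊆ ⋃ x, s x := by
      intro V hV
      simp only [Set.mem_setOf_eq] at hV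
      by_contra hcon
      simp only [Set.mem_iUnion, not_exists] at hcon
      have hfine : ∀ q : Plaq (F.P K) k, blockOf q.src ∈ nineL →
          dist1 (GaugeField.plaqHol
            (Averaging.iter (fun j => BlockAveraging.blockAvg (P := F.P K) (j := j) su2Mean) k
              (ofConfig (P := F.P K) (j := 0) V)) q) < a := by
        intro q hq
        obtain ⟨i, hi⟩ := List.mem_iff_get.1 hq
        set r : Fin (F.P K).d → Fin (F.P K).L := Site.blockEquiv hj (nineL.get i) ⟨q.src, hi.symm⟩ with hr
        have hqr : Site.blockSite (nineL.get i) r = q.src := by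
          have e := (Site.blockEquiv hj (nineL.get i)).symm_apply_apply ⟨q.src, hi.symm⟩
          rw [← hr] at e
          exact congrArg Subtype.val e
        have hx := hcon (i, (r, (q.μ, q.ν)))
        simp only [s, dif_pos q.hμν, Set.mem_setOf_eq, not_le, hqr] at hx
        exact hx
      have hlt := dist1_plaqHol_blockAvg_su2Mean_lt_local (P := F.P K) (j := k) hj ha0.le
        (U := Averaging.iter (fun j => BlockAveraging.blockAvg (P := F.P K) (j := j) su2Mean) k
          (ofConfig (P := F.P K) (j := 0) V)) pl (fun q hq => hfine q hq) hguard
      rw [hconst] at hlt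
      exact absurd (hV.trans_lt hlt) (lt_irrefl _)
    -- (ii) the count: `9 · L⁴ · 16` labels
    have hcardι : (Fintype.card (Fin nineL.length × ((Fin (F.P K).d → Fin (F.P K).L) × (Fin (F.P K).d × Fin (F.P K).d))) : ℝ)
        = N := by
      rw [hN, Fintype.card_prod, Fintype.card_prod, Fintype.card_prod, Fintype.card_fun, Fintype.card_fin, Fintype.card_fin,
        Fintype.card_fin, hlen, hPL, hPd]
      push_cast
      ring
    -- (iii) each label: the induction hypothesis at `(a, ε/N)`; then the union bound
    have hone : ∀ x, μ.real (s x) ≤ ε / N := by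
      rintro ⟨i, r, κμ, κν⟩
      by_cases h : κμ < κν
      · simp only [s, dif_pos h]
        exact hβ₄ β hβ F K hFL hk' _
      · simp only [s, dif_neg h, measureReal_empty]
        positivity
    have hsum : μ.real {V | δ ≤ dist1 (GaugeField.plaqHol (Q V) pl)} ≤ ε := by
      calc μ.real {V | δ ≤ dist1 (GaugeField.plaqHol (Q V) pl)}
          ≤ μ.real (⋃ x, s x) := measureReal_mono hsub (measure_ne_top _ _)
        _ ≤ ∑ x, μ.real (s x) := measureReal_iUnion_fintype_le _
        _ ≤ ∑ _x : Fin nineL.length × ((Fin (F.P K).d → Fin (F.P K).L) × (Fin (F.P K).d × Fin (F.P K).d)), ε / N :=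
            Finset.sum_le_sum fun x _ => hone x
        _ = N * (ε / N) := by rw [Finset.sum_const, Finset.card_univ, nsmul_eq_mul, hcardι]
        _ = ε := by field_simp
    exact hsum

end Summit.QuantumFields.YangMills.Cruxes.UVSeamRec.RarityUnionBound

end
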